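import Literature.MathematicalPhysics.KineticTheory.HardSphereEulerLLN

/-!
# Mesoscopic LLN for local Gibbs states — I: the `L¹` tree bound; the one-point expectation

Helper file for item stmt-AtomisticToContinuum-9524 (`MesoscopicLLN`, routes
`CollisionIsometryCLT` / `StiffCollisionalRelaxation`).

The macroscopic law of large numbers of the tree (`HardSphereEulerLLN`) bounds the decorated
activities `W^g(k)` of the canonical hard-sphere gas by the **sup norm** of the one-body observable
`g` (`abs_Wd_le`: `|W^g(k)| ≤ ‖g‖_∞ t(k) p^{k-1}`). At the mesoscopic scale the observables are the
translates `φ_N(· - x)` of a kernel of sup norm `≍ (N+1)^{3γ} → ∞` but of unit mass, and the bound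
that survives is the one by the **`L¹(μ)` norm at the root**:

* `integral_abs_mul_abs_uR_le`, `abs_decAct_le_integral`, `abs_Wd_le_integral`,
  `abs_coefN_le_integral`: `|C(m, j) W^g_N(j+1)| ≤ (∫ |g| dμ) · e (eλ)ʲ` — the tree-graph
  inequality `lintegral_mul_aU_le` of `HardCoreCanonical` already carries an arbitrary weight
  `φ ≥ 0` at the root; we take `φ = |g|`.
* `integral_μ_le`: `∫ g dμ ≤ M ∫ g dy` for `g ≥ 0` (`M = sup β`);
* `Md_sub`, `onePt_sub`, `abs_onePt_sub_onePt_le`, `onePt_nonneg`: linearity, continuity in the sup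
  norm and positivity of the one-point expectation `E_{N+1-s}[g(x₀)]`.

References: Pulvirenti–Tsagkarogiannis, Comm. Math. Phys. 316 (2012) §4 (tree-graph bound);
Spohn 1991, Part I §2.3.
-/

namespace Summit.AtomisticToContinuum.HydrodynamicLimit.Theorems.MesoLLN

open MeasureTheory ProbabilityTheory Finset Filter Topology
open Literature.Probability.LatticeModels Literature.MathematicalPhysics.StatisticalMechanics
open Literature.MathematicalPhysics.KineticTheory
open Literature.Analysis.FluidPDE (Config)
open Literature.Analysis.FluidPDE.Torus (euclidDist reprSym)
open Literature.Analysis.FunctionSpaces (Torus.proj)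
open scoped ENNReal

noncomputable section

section Abstract

variable {ι : Type*} [Fintype ι] [DecidableEq ι] {X : Type*} [MeasurableSpace X]
variable {O : X → X → Prop} (ν : Measure X) [IsProbabilityMeasure ν]

/-- **Tree bound with an `L¹` weight at the root**: for `O` symmetric measurable with
`ν{y : O z y} ≤ p`, a bounded measurable one-body observable `g` and `i ∈ B`,
`∫ |g(x_i)| |u_B(x)| dℙ ≤ (∫ |g| dν) · t(#B) p^{#B-1}` (the weighted tree-graph inequality
`lintegral_mul_aU_le` with the weight `|g|` at the root, in real form). -/
theorem integral_abs_mul_abs_uR_le (hO : MeasurableSet {p : X × X | O p.1 p.2})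
    (hOs : ∀ a b, O a b → O b a) {p : ℝ} (hp0 : 0 ≤ p)
    (hp : ∀ z, ν {y | O z y} ≤ ENNReal.ofReal p) {g : X → ℝ} (hg : Measurable g) {C : ℝ}
    (hgC : ∀ y, |g y| ≤ C) {i : ι} {B : Finset ι} (hi : i ∈ B) :
    ∫ x, |g (x i)| * |uR O x B| ∂Measure.pi (fun _ : ι => ν) ≤
      (∫ y, |g y| ∂ν) * (treeNumber B.card * p ^ (B.card - 1)) := by
  have hC : 0 ≤ C := (abs_nonneg _).trans (hgC (Filter.nonempty_of_neBot (ae ν)).some)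
  have h := lintegral_mul_aU_le ν hO hOs hp0 hp B hi (φ := fun y => ENNReal.ofReal |g y|)
    hg.abs.ennreal_ofReal
  have hgi : Measurable fun x : ι → X => g (x i) := hg.comp (measurable_pi_apply i)
  -- the left-hand side as a Bochner integral
  have hint : Integrable (fun x : ι → X => |g (x i)| * |uR O x B|) (Measure.pi fun _ : ι => ν) :=
    integrable_pi_of_bounded ν (hgi.abs.mul (measurable_uR hO B).abs)
      (C := C * hcUrsellBound B) fun x => by
        rw [abs_mul, abs_abs, abs_abs]
        exact mul_le_mul (hgC _) (abs_uR_le x B) (abs_nonneg _) hC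
  have hL : ∫⁻ x, ENNReal.ofReal |g (x i)| * aU O x B ∂Measure.pi (fun _ : ι => ν) =
      ENNReal.ofReal (∫ x, |g (x i)| * |uR O x B| ∂Measure.pi (fun _ : ι => ν)) := by
    rw [ofReal_integral_eq_lintegral_ofReal hint (ae_of_all _ fun x =>
      mul_nonneg (abs_nonneg _) (abs_nonneg _))]
    refine lintegral_congr fun x => ?_
    rw [aU, ← ENNReal.ofReal_mul (abs_nonneg _)]
  -- the weight integral as a Bochner integral
  have hgint : Integrable (fun y => |g y|) ν :=
    (integrable_const C).mono' hg.abs.aestronglyMeasurable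
      (ae_of_all _ fun y => by rw [Real.norm_eq_abs, abs_abs]; exact hgC y)
  have hR : ∫⁻ y, ENNReal.ofReal |g y| ∂ν = ENNReal.ofReal (∫ y, |g y| ∂ν) :=
    (ofReal_integral_eq_lintegral_ofReal hgint (ae_of_all _ fun y => abs_nonneg _)).symm
  rw [hL, hR, ← ENNReal.ofReal_mul (integral_nonneg fun y => abs_nonneg _)] at h
  exact (ENNReal.ofReal_le_ofReal_iff (mul_nonneg (integral_nonneg fun y => abs_nonneg _)
    (by positivity))).1 h

/-- `|w^g(B)| ≤ (∫ |g| dν) t(#B) p^{#B-1}`: the decorated activity is controlled by the `L¹(ν)`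
norm of the (bounded measurable) observable at the marked label. -/
theorem abs_decAct_le_integral (hO : MeasurableSet {p : X × X | O p.1 p.2})
    (hOs : ∀ a b, O a b → O b a) {p : ℝ} (hp0 : 0 ≤ p)
    (hp : ∀ z, ν {y | O z y} ≤ ENNReal.ofReal p) {g : X → ℝ} (hg : Measurable g) {C : ℝ}
    (hgC : ∀ y, |g y| ≤ C) {i : ι} {B : Finset ι} (hi : i ∈ B) :
    |decAct O ν g i B| ≤ (∫ y, |g y| ∂ν) * (treeNumber B.card * p ^ (B.card - 1)) := by
  refine le_trans ?_ (integral_abs_mul_abs_uR_le ν hO hOs hp0 hp hg hgC hi)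
  unfold decAct
  refine (Real.norm_eq_abs _).symm.trans_le ((norm_integral_le_integral_norm _).trans_eq
    (integral_congr_ae (ae_of_all _ fun x => ?_)))
  dsimp only
  rw [Real.norm_eq_abs, abs_mul]

end Abstract

/-! ### Size forms along the hydrodynamic scaling -/

section Torus

variable {P : DensityProfile} {ε σ : ℝ} {n : ℕ}

/-- **`L¹` tree bound, size form**: `|W^g(k)| ≤ (∫ |g| dμ) t(k) p_ε^{k-1}` for `1 ≤ k ≤ n`,
`0 ≤ ε < 1/2`, `g` bounded measurable. -/
theorem abs_Wd_le_integral [NeZero n] (hε : 0 ≤ ε) (hε2 : ε < 1 / 2) {g : T3 → ℝ}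
    (hg : Measurable g) {C : ℝ} (hgC : ∀ y, |g y| ≤ C) {k : ℕ} (hk1 : 1 ≤ k) (hkn : k ≤ n) :
    |Wd P ε n g k| ≤ (∫ y, |g y| ∂P.μ) * (treeNumber k * pOv P ε ^ (k - 1)) := by
  have h := abs_decAct_le_integral P.μ (measurableSet_ov ε) (ov_symm ε) (pOv_nonneg P hε)
    (μ_ov_le_pOv P hε hε2) hg hgC (i := (0 : Fin n)) (B := firstLabels n k)
    (zero_mem_firstLabels hk1)
  rwa [card_firstLabels hkn] at h

/-- **`L¹` bound on the coefficients**: `|C(m, j) W^g_N(j+1)| ≤ (∫ |g| dμ) e (eλ)ʲ` for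
`j ≤ N`, `m ≤ N + 1` (as `abs_coefN_le`, with the sup norm replaced by the `L¹(μ)` norm). -/
theorem abs_coefN_le_integral (hσ : 0 ≤ σ) (hσ2 : σ < 1 / 2) {g : T3 → ℝ} (hg : Measurable g)
    {C : ℝ} (hgC : ∀ y, |g y| ≤ C) {N m j : ℕ} (hj : j ≤ N) (hm : m ≤ N + 1) :
    |coefN P σ N g m j| ≤ (∫ y, |g y| ∂P.μ) * (Real.exp 1 * (Real.exp 1 * ovDensity P σ) ^ j) := by
  have hL : 0 ≤ ∫ y, |g y| ∂P.μ := integral_nonneg fun y => abs_nonneg _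
  have hp : 0 ≤ pOv P (hsDiameter σ N) := pOv_nonneg P (hsDiameter_nonneg' hσ N)
  have hW := abs_Wd_le_integral (P := P) (n := N + 1) (hsDiameter_nonneg' hσ N)
    (hsDiameter_lt_half hσ hσ2 N) hg hgC (k := j + 1) (by omega) (by omega)
  rw [Nat.add_sub_cancel] at hW
  have hchoose : (m.choose j : ℝ) ≤ (m : ℝ) ^ j / j.factorial := Nat.choose_le_pow_div j m
  rw [coefN, abs_mul, Nat.abs_cast]
  calc (m.choose j : ℝ) * |Wd P (hsDiameter σ N) (N + 1) g (j + 1)|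
      ≤ ((m : ℝ) ^ j / j.factorial) *
          ((∫ y, |g y| ∂P.μ) * (treeNumber (j + 1) * pOv P (hsDiameter σ N) ^ j)) :=
        mul_le_mul hchoose hW (abs_nonneg _) (by positivity)
    _ = (∫ y, |g y| ∂P.μ) *
          ((treeNumber (j + 1) : ℝ) * ((m : ℝ) * pOv P (hsDiameter σ N)) ^ j / j.factorial) := by
        rw [mul_pow]; ring
    _ ≤ (∫ y, |g y| ∂P.μ) * ((treeNumber (j + 1) : ℝ) * (ovDensity P σ) ^ j / j.factorial) := by
        gcongr
        exact mul_pOv_le_ovDensity hσ hm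
    _ ≤ (∫ y, |g y| ∂P.μ) * (Real.exp 1 * (Real.exp 1 * ovDensity P σ) ^ j) :=
        mul_le_mul_of_nonneg_left
          (treeNumber_succ_mul_pow_div_factorial_le (ovDensity_nonneg hσ) j) hL

/-! ### The `μ`-integral against the sup of the profile -/

/-- The `μ`-integral of a nonnegative function is at most `M` times its Haar integral. -/
theorem integral_μ_le (P : DensityProfile) {g : T3 → ℝ} (hg0 : ∀ y, 0 ≤ g y)
    (hgi : Integrable g) : ∫ y, g y ∂P.μ ≤ P.M * ∫ y, g y := by
  rw [P.integral_μ, ← integral_const_mul]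
  refine integral_mono_of_nonneg (ae_of_all _ fun y => mul_nonneg (P.pos y).le (hg0 y))
    (hgi.const_mul _) (ae_of_all _ fun y => ?_)
  exact mul_le_mul_of_nonneg_right (P.le_M y) (hg0 y)

/-! ### Linearity of the one-point expectation -/

/-- `M^{g₁ - g₂}(m) = M^{g₁}(m) - M^{g₂}(m)` for bounded measurable observables. -/
theorem Md_sub [NeZero n] {g₁ g₂ : T3 → ℝ} (hg₁ : Measurable g₁) (hg₂ : Measurable g₂)
    {C₁ C₂ : ℝ} (h₁ : ∀ y, |g₁ y| ≤ C₁) (h₂ : ∀ y, |g₂ y| ≤ C₂) (m : ℕ) :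
    Md P ε n (fun y => g₁ y - g₂ y) m = Md P ε n g₁ m - Md P ε n g₂ m := by
  have hO := measurableSet_ov ε
  have hC₁ : 0 ≤ C₁ := (abs_nonneg _).trans (h₁ 0)
  have hC₂ : 0 ≤ C₂ := (abs_nonneg _).trans (h₂ 0)
  have hi₁ : Integrable (fun x : Fin n → T3 => g₁ (x 0) * efR (Ov ε) x (firstLabels n m))
      (Measure.pi fun _ : Fin n => P.μ) :=
    integrable_pi_of_bounded P.μ ((hg₁.comp (measurable_pi_apply 0)).mul (measurable_efR hO _))
      (C := C₁ * 1) fun x => by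
        rw [abs_mul]; exact mul_le_mul (h₁ _) (abs_efR_le_one x _) (abs_nonneg _) hC₁
  have hi₂ : Integrable (fun x : Fin n → T3 => g₂ (x 0) * efR (Ov ε) x (firstLabels n m))
      (Measure.pi fun _ : Fin n => P.μ) :=
    integrable_pi_of_bounded P.μ ((hg₂.comp (measurable_pi_apply 0)).mul (measurable_efR hO _))
      (C := C₂ * 1) fun x => by
        rw [abs_mul]; exact mul_le_mul (h₂ _) (abs_efR_le_one x _) (abs_nonneg _) hC₂
  simp only [Md, decPF]
  rw [← integral_sub hi₁ hi₂]
  refine integral_congr_ae (ae_of_all _ fun x => ?_)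
  dsimp only
  ring

/-- `E[(g₁ - g₂)(x₀)] = E[g₁(x₀)] - E[g₂(x₀)]`. -/
theorem onePt_sub {g₁ g₂ : T3 → ℝ} (hg₁ : Measurable g₁) (hg₂ : Measurable g₂)
    {C₁ C₂ : ℝ} (h₁ : ∀ y, |g₁ y| ≤ C₁) (h₂ : ∀ y, |g₂ y| ≤ C₂) (N s : ℕ) :
    onePt P σ (fun y => g₁ y - g₂ y) N s = onePt P σ g₁ N s - onePt P σ g₂ N s := by
  rw [onePt, onePt, onePt, Md_sub hg₁ hg₂ h₁ h₂, sub_div]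

/-- **Uniformly close observables have close one-point expectations**:
`|E[g₁(x₀)] - E[g₂(x₀)]| ≤ η` whenever `|g₁ - g₂| ≤ η` pointwise (small density). -/
theorem abs_onePt_sub_onePt_le (h : SmallDensity P σ) {g₁ g₂ : T3 → ℝ} (hg₁ : Measurable g₁)
    (hg₂ : Measurable g₂) {C₁ C₂ : ℝ} (h₁ : ∀ y, |g₁ y| ≤ C₁) (h₂ : ∀ y, |g₂ y| ≤ C₂) {η : ℝ}
    (hη : ∀ y, |g₁ y - g₂ y| ≤ η) (N s : ℕ) :
    |onePt P σ g₁ N s - onePt P σ g₂ N s| ≤ η := by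
  rw [← onePt_sub hg₁ hg₂ h₁ h₂]
  exact h.abs_onePt_le (hg₁.sub hg₂) hη N s

/-- The one-point expectation of a nonnegative observable is nonnegative (small density). -/
theorem onePt_nonneg (h : SmallDensity P σ) {g : T3 → ℝ} (hg0 : ∀ y, 0 ≤ g y) (N s : ℕ) :
    0 ≤ onePt P σ g N s := by
  have hXi := XiN_pos h.σ_pos.le h.σ_lt_half h.ovDensity_lt_one (N := N) (m := N + 1 - s)
    (Nat.sub_le _ _)
  rw [onePt]
  refine div_nonneg (integral_nonneg fun x => mul_nonneg (hg0 _) (efR_nonneg x _)) hXi.le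

end Torus

end

end Summit.AtomisticToContinuum.HydrodynamicLimit.Theorems.MesoLLN
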